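import Summits.KontsevichZagierPeriods.KontsevichZagierPeriods.Theorems.LiouvilleUnfoldingAyoubPiLocalKernelBoundedInvariants
import Summits.KontsevichZagierPeriods.KontsevichZagierPeriods.Theorems.LiouvilleUnfoldingAyoubPiLocalKernelVolumeForm

/-!
# Crux stmt-KontsevichZagierPeriods-0541 (`AyoubPiLocalKernel`): tame complex points of the formal
# period ring are the Lebesgue point

Support file (`--supports` stmt-KontsevichZagierPeriods-0541, line `SketchIdeator2` = card
`nilradical-cut`, lead cycle 4; companion of `…ComplexPoints.lean`).  Over `P := KZ.FormalPeriodRing`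
with `evalP : P →+* ℝ` and `ϖ := KZ.toFormalPeriod (KZ.of KZ.piRep)`, the transcendence stub (N) of the
line reads, on complex points, "every ring homomorphism `θ : P →+* ℂ` with `θ ϖ ≠ 0` kills `ker evalP`"
(`nilLocalKernel_iff_complexPoints`), so a refutation of (N) is a complex-valued multiplicative
integration theory `θ` of the four-move calculus together with a class `x` of value `0`, `θ x ≠ 0`.
This file records what such a `θ` cannot be, transporting the real rigidity theorems of the line
(p138353 `monotone_points_eq_evalP`, p140181 `additive_eq_mul_evalP_of_bounded`) to `ℂ`:

* `complexPoint_eq_evalP_of_norm_bounded` — a complex point **bounded in norm on bodies of volume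
  `≤ 1`** (bounded `ℚ`-semialgebraic domains, integrand `1`) is the Lebesgue point
  `Complex.ofReal ∘ evalP`;
* `complexPoint_eq_evalP_of_nonneg_on_bodies` — a complex point taking **non-negative real values on
  compact bodies** is the Lebesgue point;
* `complexPoint_wild_of_not_ker_le` — hence a complex point NOT killing `ker evalP` (in particular any
  refutation of (N), and any prime of `P` other than specialisations of `ker evalP` realised in `ℂ`)
  is unbounded in norm on bodies of volume `≤ 1` and takes a non-real or negative value on some compact
  body.

So the only "analytically tame" complex integration theory of the calculus is Lebesgue's; a kill of the
transcendence stub is necessarily an integration theory with no continuity and no positivity.  No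
definition is introduced.  [Kontsevich–Zagier 2001, §1.2; Ayoub 2014, Conj. 7 and Rem. 8]
-/

noncomputable section

open Set
open Literature.NumberTheory.Transcendental

namespace Summit.KontsevichZagierPeriods.LiouvilleUnfolding.NilradicalCut

/-- **A complex point bounded on small bodies is the Lebesgue point.**  If `θ : P →+* ℂ` satisfies
`‖θ ⟦A⟧‖ ≤ M` for every representation `A` with bounded domain, integrand `1` and volume `≤ 1`, then
`θ = Complex.ofReal ∘ evalP`: real and imaginary part are bounded additive invariants, hence multiples
`(θ 1).re • evalP = evalP` and `(θ 1).im • evalP = 0` of the evaluation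
(`additive_eq_mul_evalP_of_bounded`). [folklore] -/
theorem complexPoint_eq_evalP_of_norm_bounded : ∀ (θ : KZ.FormalPeriodRing →+* ℂ),
    (∃ M : ℝ, ∀ (m : ℕ) (A : KZ.IntegralRep m), Bornology.IsBounded A.domain →
      (∀ x ∈ A.domain, A.integrand x = 1) → A.value ≤ 1 → ‖θ (KZ.toFormalPeriod (KZ.of A))‖ ≤ M) →
        ∀ x : KZ.FormalPeriodRing, θ x = (KZ.evalP x : ℂ) := by
  intro θ hb x
  obtain ⟨M, hM⟩ := hb
  let ρ : KZ.FormalPeriodRing →+ ℝ :=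
    AddMonoidHom.mk' (fun y => (θ y).re) fun a b => by simp only [map_add, Complex.add_re]
  let ι : KZ.FormalPeriodRing →+ ℝ :=
    AddMonoidHom.mk' (fun y => (θ y).im) fun a b => by simp only [map_add, Complex.add_im]
  have hre : (θ x).re = (θ 1).re * KZ.evalP x :=
    additive_eq_mul_evalP_of_bounded ρ
      ⟨M, fun m A h1 h2 h3 => (Complex.abs_re_le_norm _).trans (hM m A h1 h2 h3)⟩ x
  have him : (θ x).im = (θ 1).im * KZ.evalP x :=
    additive_eq_mul_evalP_of_bounded ι
      ⟨M, fun m A h1 h2 h3 => (Complex.abs_im_le_norm _).trans (hM m A h1 h2 h3)⟩ x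
  rw [map_one, Complex.one_re, one_mul] at hre
  rw [map_one, Complex.one_im, zero_mul] at him
  apply Complex.ext
  · rw [hre, Complex.ofReal_re]
  · rw [him, Complex.ofReal_im]

/-- Under a complex point that is REAL on compact bodies, every class has real image (every class is a
difference of two compact bodies, `exists_body_sub_body`). [folklore] -/
theorem complexPoint_im_eq_zero_of_real_on_bodies (θ : KZ.FormalPeriodRing →+* ℂ)
    (hreal : ∀ (m : ℕ) (K : KZ.IntegralRep m), IsCompact K.domain → (interior K.domain).Nonempty →
      (∀ x ∈ K.domain, K.integrand x = 1) → (θ (KZ.toFormalPeriod (KZ.of K))).im = 0)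
    (x : KZ.FormalPeriodRing) : (θ x).im = 0 := by
  obtain ⟨k, K₁, K₂, hK₁c, hK₁i, hK₂c, hK₂i, hK₁1, hK₂1, hx, -⟩ := exists_body_sub_body x
  rw [hx, map_sub, Complex.sub_im, hreal _ K₁ hK₁c hK₁i hK₁1, hreal _ K₂ hK₂c hK₂i hK₂1, sub_zero]

/-- **A complex point non-negative on compact bodies is the Lebesgue point.**  If `θ : P →+* ℂ` takes
a non-negative REAL value on (the class of) every compact body with non-empty interior and integrand
`1`, then `θ = Complex.ofReal ∘ evalP`: `θ` is real everywhere (`complexPoint_im_eq_zero_of_real_on_bodies`),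
so its real part is a ring homomorphism `P →+* ℝ` monotone on bodies, which is `evalP`
(`monotone_points_eq_evalP`, p138353). [folklore] -/
theorem complexPoint_eq_evalP_of_nonneg_on_bodies (θ : KZ.FormalPeriodRing →+* ℂ)
    (hpos : ∀ (m : ℕ) (K : KZ.IntegralRep m), IsCompact K.domain → (interior K.domain).Nonempty →
      (∀ x ∈ K.domain, K.integrand x = 1) →
        0 ≤ (θ (KZ.toFormalPeriod (KZ.of K))).re ∧ (θ (KZ.toFormalPeriod (KZ.of K))).im = 0)
    (x : KZ.FormalPeriodRing) : θ x = (KZ.evalP x : ℂ) := by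
  have him : ∀ y : KZ.FormalPeriodRing, (θ y).im = 0 :=
    complexPoint_im_eq_zero_of_real_on_bodies θ fun m K h1 h2 h3 => (hpos m K h1 h2 h3).2
  -- the real part of `θ` is a ring homomorphism
  let θr : KZ.FormalPeriodRing →+* ℝ :=
    { toFun := fun y => (θ y).re
      map_one' := by simp only [map_one, Complex.one_re]
      map_mul' := fun a b => by simp only [map_mul, Complex.mul_re, him, mul_zero, sub_zero]
      map_zero' := by simp only [map_zero, Complex.zero_re]
      map_add' := fun a b => by simp only [map_add, Complex.add_re] }
  have hθr : θr = KZ.evalP :=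
    monotone_points_eq_evalP θr fun m K h1 h2 h3 => (hpos m K h1 h2 h3).1
  have hre : (θ x).re = KZ.evalP x := by rw [← hθr]; rfl
  apply Complex.ext
  · rw [hre, Complex.ofReal_re]
  · rw [him, Complex.ofReal_im]

/-- **A complex point not killing the value-kernel is wild.**  If `θ : P →+* ℂ` does not vanish on
some class of value `0` — e.g. a refutation of the transcendence stub (N) of item 0541
(`not_nilLocalKernel_iff_exists_complexPoint`), or the complex realisation of any prime of `P` not
containing `ker evalP` — then (i) `θ` is unbounded in norm on bodies of volume `≤ 1`, and (ii) `θ`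
takes a negative or non-real value on some compact body with non-empty interior.  [folklore] -/
theorem complexPoint_wild_of_not_ker_le (θ : KZ.FormalPeriodRing →+* ℂ)
    (hx : ∃ x : KZ.FormalPeriodRing, KZ.evalP x = 0 ∧ θ x ≠ 0) :
    (∀ M : ℝ, ∃ (m : ℕ) (A : KZ.IntegralRep m), Bornology.IsBounded A.domain ∧
        (∀ x ∈ A.domain, A.integrand x = 1) ∧ A.value ≤ 1 ∧
          M < ‖θ (KZ.toFormalPeriod (KZ.of A))‖) ∧
      ∃ (m : ℕ) (K : KZ.IntegralRep m), IsCompact K.domain ∧ (interior K.domain).Nonempty ∧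
        (∀ x ∈ K.domain, K.integrand x = 1) ∧
          ((θ (KZ.toFormalPeriod (KZ.of K))).re < 0 ∨ (θ (KZ.toFormalPeriod (KZ.of K))).im ≠ 0) := by
  obtain ⟨x, hx0, hθx⟩ := hx
  constructor
  · intro M
    by_contra hcon
    push Not at hcon
    apply hθx
    rw [complexPoint_eq_evalP_of_norm_bounded θ ⟨M, fun m A h1 h2 h3 => hcon m A h1 h2 h3⟩ x, hx0,
      Complex.ofReal_zero]
  · by_contra hcon
    push Not at hcon
    apply hθx
    rw [complexPoint_eq_evalP_of_nonneg_on_bodies θ (fun m K h1 h2 h3 => hcon m K h1 h2 h3) x, hx0,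
      Complex.ofReal_zero]

end Summit.KontsevichZagierPeriods.LiouvilleUnfolding.NilradicalCut

end
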